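import Summits.CriticalPhenomena.PercolationContinuityZ3.Theorems.PercNearOneGluingNoHeavyLowerTailSahiGridPatternHarrisReduced

/-!
# `NoHeavyLowerTail` (crux stmt-CriticalPhenomena-4575), Sahi programme P1: **THE TWO-CHART TRANSPORT LEMMA** — the abstract
# counting inequality behind 'every top-cube up-set is a good slot in every dimension' (generation 18's ABSTRACT CLAIM AC(t,t′))

Support file (Sahi cell, seat `prim-sahi-p1`, generation 19; `--supports stmt-CriticalPhenomena-4575`).  Pure proofs, NO definitions,
no `sorry`, standard axioms.  Vocabulary: the integer indicator `ind` of `…SahiGridThreeKernel`; everything else is Mathlib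
(`IsUpperSet` / `IsLowerSet` for the product partial order on `α × β`, Harris–Kleitman for set families).

THE MATHEMATICS (abstract, two finite posets `α`, `β`; in the application `α = 2^T`, `β = 2^{Tᶜ}` are the two blocks of a chart
`T ⊆ [k]` of the top cube `{1,2}^k ⊆ [3]^k`).  DATA: up-sets `U, b, c ⊆ α × β`; 'arms' `A_b, A_c ⊆ α`, `G_b, G_c ⊆ β` (up-sets) with
`A_b × β ∪ α × G_b ⊆ b`, `A_c × β ∪ α × G_c ⊆ c`; down-sets `D₁, D₂ ⊆ α`, `E₁, E₂ ⊆ β` that are HK-DOMINATED by the arms: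
`#(V ∩ D₁) ≤ #(V ∩ A_b)`, `#(V ∩ D₂) ≤ #(V ∩ A_c)` for every up-set `V ⊆ α` and `#(W ∩ E₁) ≤ #(W ∩ G_c)`, `#(W ∩ E₂) ≤ #(W ∩ G_b)`
for every up-set `W ⊆ β` (for Boolean lattices this follows from `#D₁ ≤ #A_b` etc. by Harris–Kleitman:
`card_inter_le_card_inter_of_card_le`).  CLAIM (**`twoChart_sum_nonneg`**):
  `Σ_{(x,y) ∈ U} [ (1_{D₁}(x) − 1_b(x,y))·(1_{E₁}(y) − 1_c(x,y)) + (1_{E₂}(y) − 1_b(x,y))·(1_{D₂}(x) − 1_c(x,y)) ] ≥ 0`.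
PROOF (a transport of the negative units on `b △ c` to the positive units on `b ∩ c`, by pure counting).  Positive units:
`P1 = U∩b∩c∩(D̄₁×Ē₁)`, `P2 = U∩b∩c∩(D̄₂×Ē₂)`; negative: `N1 = U∩(b∖c)∩(D̄₁×E₁)`, `N3 = U∩(c∖b)∩(D₁×Ē₁)`, `N2 = U∩(b∖c)∩(D₂×Ē₂)`,
`N4 = U∩(c∖b)∩(D̄₂×E₂)` (the units at `b = c = 0` are `≥ 0` and dropped).  Row/column HK-domination gives `N1 ≤ R1 := #U∩b∩((D̄₁∖A_c)×(G_c∖E₁))`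
(rows), `N3 ≤ R3 := #U∩c∩((A_b∖D₁)×(Ē₁∖G_b))` (columns), `N2 ≤ R2`, `N4 ≤ R4` (mirror); `R1, R3 ⊆ P1` overlap exactly in
`K1 := (A_b∖(D₁∪A_c)) × (G_c∖(E₁∪G_b))`, and two more HK steps give `#U∩K1 ≤ #U∩Z1`, `Z1 := (A_b∖(D₁∪D₂)) × (G_c∖(E₁∪E₂)) ⊆ P2 ∖ (R2 ∪ R4)`;
with the mirror `K2 ≤ Z2 ⊆ P1 ∖ (R1 ∪ R3)`: `P1 ≥ R1 + R3 − K1 + Z2`, `P2 ≥ R2 + R4 − K2 + Z1` (pointwise), and summing closes the count.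
The application to the pattern functional is the companion file `…SahiGridPatternTopCube`.  Nothing here mentions `sStarD`;
nothing asserts `PatternPos d` for any `d ≥ 4`. [this work]
-/

namespace Summit.CriticalPhenomena.PercolationContinuityZ3.Theorems.SahiGridPattern

open Finset SahiGrid3
open scoped BigOperators

section IndGeneric

variable {γ : Type*} [DecidableEq γ]

/-- `Σ_y 1_V(y)·1_E(y) = #(V ∩ E)`. [this work] -/
theorem sum_ind_mul_ind_eq_card_inter' [Fintype γ] (V E : Finset γ) :
    (∑ y, ind V y * ind E y) = ((V ∩ E).card : ℤ) := by
  have h : ∀ y, ind V y * ind E y = ind (V ∩ E) y := fun y => (ind_inter_eq_mul V E y).symm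
  simp only [h]
  unfold ind
  rw [Finset.sum_boole, Finset.filter_mem_eq_inter, Finset.univ_inter]

/-- A sum over a finset as an indicator-weighted sum over the whole type. [this work] -/
theorem sum_mem_eq_sum_ind_mul [Fintype γ] (S : Finset γ) (f : γ → ℤ) : (∑ x ∈ S, f x) = ∑ x, ind S x * f x := by
  unfold ind
  rw [← Finset.sum_filter_add_sum_filter_not univ (· ∈ S)]
  rw [Finset.filter_mem_eq_inter, Finset.univ_inter]
  have h0 : (∑ x ∈ univ.filter (fun x => ¬ x ∈ S), (if x ∈ S then (1:ℤ) else 0) * f x) = 0 :=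
    Finset.sum_eq_zero fun x hx => by rw [mem_filter] at hx; rw [if_neg hx.2]; ring
  rw [h0, add_zero]
  exact Finset.sum_congr rfl fun x hx => by rw [if_pos hx]; ring

/-- Implications between memberships as inequalities of indicators. [this work] -/
theorem ind_le_ind_of_imp {δ : Type*} [DecidableEq δ] {S : Finset γ} {T : Finset δ} {x : γ} {y : δ}
    (h : x ∈ S → y ∈ T) : ind S x ≤ ind T y := by
  unfold ind
  by_cases hx : x ∈ S
  · rw [if_pos hx, if_pos (h hx)]
  · rw [if_neg hx]; split_ifs <;> norm_num

/-- `1_S ≤ 1`. [this work] -/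
theorem ind_le_one' (S : Finset γ) (y : γ) : ind S y ≤ 1 := by
  unfold ind; split_ifs <;> norm_num

/-- A product of two `0/1`-valued integers is `0/1`-valued. [this work] -/
theorem mul_zero_or_one {a b : ℤ} (ha : a = 0 ∨ a = 1) (hb : b = 0 ∨ b = 1) : a * b = 0 ∨ a * b = 1 := by
  rcases ha with rfl | rfl <;> rcases hb with rfl | rfl <;> simp

/-- `1 - a` is `0/1`-valued if `a` is. [this work] -/
theorem one_sub_zero_or_one {a : ℤ} (ha : a = 0 ∨ a = 1) : 1 - a = 0 ∨ 1 - a = 1 := by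
  rcases ha with rfl | rfl <;> simp

/-- **Harris–Kleitman domination** for set families: an upper family `𝒱` meets a lower family `𝒟` at most as often as it meets an
upper family `𝒜` with `#𝒟 ≤ #𝒜` (Kleitman: `2^n·#(𝒱∩𝒟) ≤ #𝒱·#𝒟`; Harris: `#𝒱·#𝒜 ≤ 2^n·#(𝒱∩𝒜)`). [this work] -/
theorem card_inter_le_card_inter_of_card_le [Fintype γ] {𝒱 𝒜 𝒟 : Finset (Finset γ)}
    (h𝒱 : IsUpperSet (𝒱 : Set (Finset γ))) (h𝒜 : IsUpperSet (𝒜 : Set (Finset γ))) (h𝒟 : IsLowerSet (𝒟 : Set (Finset γ)))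
    (hcard : 𝒟.card ≤ 𝒜.card) : (𝒱 ∩ 𝒟).card ≤ (𝒱 ∩ 𝒜).card := by
  have h1 : 2 ^ Fintype.card γ * (𝒱 ∩ 𝒟).card ≤ 𝒱.card * 𝒟.card := h𝒱.card_inter_le_finset h𝒟
  have h2 : 𝒱.card * 𝒜.card ≤ 2 ^ Fintype.card γ * (𝒱 ∩ 𝒜).card := h𝒱.le_card_inter_finset h𝒜
  have h3 : 𝒱.card * 𝒟.card ≤ 𝒱.card * 𝒜.card := Nat.mul_le_mul_left _ hcard
  exact Nat.le_of_mul_le_mul_left ((h1.trans h3).trans h2) (Nat.two_pow_pos _)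

end IndGeneric

section TwoChart

variable {α β : Type*} [PartialOrder α] [PartialOrder β] [Fintype α] [Fintype β] [DecidableEq α] [DecidableEq β]

omit [Fintype α] in
/-- A row of an up-set of `α × β` is an up-set of `β`. [this work] -/
theorem isUpperSet_row {W : Finset (α × β)} (hW : IsUpperSet (W : Set (α × β))) (x : α) :
    IsUpperSet ((univ.filter fun y : β => (x, y) ∈ W : Finset β) : Set β) := by
  intro y y' hyy' hy
  rw [Finset.mem_coe, Finset.mem_filter] at hy ⊢
  exact ⟨mem_univ _, hW (show (x, y) ≤ (x, y') from ⟨le_rfl, hyy'⟩) hy.2⟩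

omit [Fintype β] in
/-- A column of an up-set of `α × β` is an up-set of `α`. [this work] -/
theorem isUpperSet_col {W : Finset (α × β)} (hW : IsUpperSet (W : Set (α × β))) (y : β) :
    IsUpperSet ((univ.filter fun x : α => (x, y) ∈ W : Finset α) : Set α) := by
  intro x x' hxx' hx
  rw [Finset.mem_coe, Finset.mem_filter] at hx ⊢
  exact ⟨mem_univ _, hW (show (x, y) ≤ (x', y) from ⟨hxx', le_rfl⟩) hx.2⟩

/-- The intersection of two up-sets (as finsets) is an up-set. [this work] -/
theorem isUpperSet_inter_coe' {γ : Type*} [Preorder γ] [DecidableEq γ] {A A' : Finset γ}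
    (hA : IsUpperSet (A : Set γ)) (hA' : IsUpperSet (A' : Set γ)) : IsUpperSet ((A ∩ A' : Finset γ) : Set γ) := by
  rw [Finset.coe_inter]; exact hA.inter hA'

omit [PartialOrder α] in
/-- **Row transport of HK-domination**: if `#(V ∩ E) ≤ #(V ∩ G)` for every up-set `V ⊆ β`, then for every `W ⊆ α × β` with up-set
rows and every weight `w ≥ 0` on `α`: `Σ_{(x,y)} 1_W·w(x)·1_E(y) ≤ Σ_{(x,y)} 1_W·w(x)·1_G(y)`. [this work] -/
theorem rowHK {E G : Finset β} (hk : ∀ V : Finset β, IsUpperSet (V : Set β) → (V ∩ E).card ≤ (V ∩ G).card)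
    (W : Finset (α × β)) (hW : ∀ x : α, IsUpperSet ((univ.filter fun y : β => (x, y) ∈ W : Finset β) : Set β))
    (w : α → ℤ) (hw : ∀ x, 0 ≤ w x) :
    (∑ p : α × β, ind W p * w p.1 * ind E p.2) ≤ ∑ p : α × β, ind W p * w p.1 * ind G p.2 := by
  rw [Fintype.sum_prod_type, Fintype.sum_prod_type]
  refine Finset.sum_le_sum fun x _ => ?_
  have hrow : ∀ y, ind W (x, y) = ind (univ.filter fun y : β => (x, y) ∈ W) y := fun y => by
    unfold ind; simp only [Finset.mem_filter, Finset.mem_univ, true_and]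
  have e1 : (∑ y, ind W (x, y) * w (x, y).1 * ind E (x, y).2) = w x * ∑ y, ind (univ.filter fun y : β => (x, y) ∈ W) y * ind E y := by
    rw [Finset.mul_sum]; exact Finset.sum_congr rfl fun y _ => by rw [hrow]; ring
  have e2 : (∑ y, ind W (x, y) * w (x, y).1 * ind G (x, y).2) = w x * ∑ y, ind (univ.filter fun y : β => (x, y) ∈ W) y * ind G y := by
    rw [Finset.mul_sum]; exact Finset.sum_congr rfl fun y _ => by rw [hrow]; ring
  rw [e1, e2, sum_ind_mul_ind_eq_card_inter', sum_ind_mul_ind_eq_card_inter']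
  exact mul_le_mul_of_nonneg_left (by exact_mod_cast hk _ (hW x)) (hw x)

omit [PartialOrder β] in
/-- **Column transport of HK-domination** (the mirror of `rowHK`). [this work] -/
theorem colHK {D A : Finset α} (hk : ∀ V : Finset α, IsUpperSet (V : Set α) → (V ∩ D).card ≤ (V ∩ A).card)
    (W : Finset (α × β)) (hW : ∀ y : β, IsUpperSet ((univ.filter fun x : α => (x, y) ∈ W : Finset α) : Set α))
    (w : β → ℤ) (hw : ∀ y, 0 ≤ w y) :
    (∑ p : α × β, ind W p * w p.2 * ind D p.1) ≤ ∑ p : α × β, ind W p * w p.2 * ind A p.1 := by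
  rw [Fintype.sum_prod_type_right, Fintype.sum_prod_type_right]
  refine Finset.sum_le_sum fun y _ => ?_
  have hcol : ∀ x, ind W (x, y) = ind (univ.filter fun x : α => (x, y) ∈ W) x := fun x => by
    unfold ind; simp only [Finset.mem_filter, Finset.mem_univ, true_and]
  have e1 : (∑ x, ind W (x, y) * w (x, y).2 * ind D (x, y).1) = w y * ∑ x, ind (univ.filter fun x : α => (x, y) ∈ W) x * ind D x := by
    rw [Finset.mul_sum]; exact Finset.sum_congr rfl fun x _ => by rw [hcol]; ring
  have e2 : (∑ x, ind W (x, y) * w (x, y).2 * ind A (x, y).1) = w y * ∑ x, ind (univ.filter fun x : α => (x, y) ∈ W) x * ind A x := by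
    rw [Finset.mul_sum]; exact Finset.sum_congr rfl fun x _ => by rw [hcol]; ring
  rw [e1, e2, sum_ind_mul_ind_eq_card_inter', sum_ind_mul_ind_eq_card_inter']
  exact mul_le_mul_of_nonneg_left (by exact_mod_cast hk _ (hW y)) (hw y)

end TwoChart

section Pointwise

/-- Pointwise: the two chart terms dominate `P1 − N1 − N3 + P2 − N2 − N4` (the units at `b = c = 0` are dropped). [this work] -/
theorem pw_main (u bb cc d1 e1 d2 e2 : ℤ) (hu : u = 0 ∨ u = 1) (hbb : bb = 0 ∨ bb = 1) (hcc : cc = 0 ∨ cc = 1)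
    (hd1 : d1 = 0 ∨ d1 = 1) (he1 : e1 = 0 ∨ e1 = 1) (hd2 : d2 = 0 ∨ d2 = 1) (he2 : e2 = 0 ∨ e2 = 1) :
    u * (1 - d1) * (1 - e1) * (bb * cc) - u * bb * (1 - cc) * (1 - d1) * e1 - u * cc * (1 - bb) * d1 * (1 - e1)
      + (u * (1 - d2) * (1 - e2) * (bb * cc) - u * bb * (1 - cc) * d2 * (1 - e2) - u * cc * (1 - bb) * (1 - d2) * e2)
      ≤ u * ((d1 - bb) * (e1 - cc) + (e2 - bb) * (d2 - cc)) := by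
  rcases hu with rfl | rfl <;> rcases hbb with rfl | rfl <;> rcases hcc with rfl | rfl <;> rcases hd1 with rfl | rfl <;>
    rcases he1 with rfl | rfl <;> rcases hd2 with rfl | rfl <;> rcases he2 with rfl | rfl <;> norm_num

/-- Pointwise step for `N1 ≤ R1` (and, with letters renamed, for `N2, N3, N4`): a point of `b ∖ c` lies outside both arms of `c`. [this work] -/
theorem pw_neg (u bb cc d e ac gc : ℤ) (hu : u = 0 ∨ u = 1) (hbb : bb = 0 ∨ bb = 1) (hcc : cc = 0 ∨ cc = 1)
    (hd : d = 0 ∨ d = 1) (he : e = 0 ∨ e = 1) (hac : ac = 0 ∨ ac = 1) (hgc : gc = 0 ∨ gc = 1) (h1 : ac ≤ cc) (h2 : gc ≤ cc) :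
    u * bb * (1 - cc) * d * e ≤ u * bb * d * (1 - ac) * (e * (1 - gc)) := by
  rcases hu with rfl | rfl <;> rcases hbb with rfl | rfl <;> rcases hcc with rfl | rfl <;> rcases hd with rfl | rfl <;>
    rcases he with rfl | rfl <;> rcases hac with rfl | rfl <;> rcases hgc with rfl | rfl <;> omega

/-- Pointwise step for `R1 + R3 − K1 + Z2 ≤ P1` (`m` = the common factor `1_U(1−1_{D₁})(1−1_{E₁})`, `n = (1−1_{D₂})(1−1_{E₂})`). [this work] -/
theorem pw_overlap (m bb cc ac gc ab gb n : ℤ) (hm : m = 0 ∨ m = 1) (hbb : bb = 0 ∨ bb = 1) (hcc : cc = 0 ∨ cc = 1)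
    (hac : ac = 0 ∨ ac = 1) (hgc : gc = 0 ∨ gc = 1) (hab : ab = 0 ∨ ab = 1) (hgb : gb = 0 ∨ gb = 1) (hn : n = 0 ∨ n = 1)
    (h1 : ab ≤ bb) (h2 : gb ≤ bb) (h3 : ac ≤ cc) (h4 : gc ≤ cc) :
    m * (bb * (1 - ac) * gc) + m * (cc * ab * (1 - gb)) - m * (ab * (1 - ac) * gc * (1 - gb)) + m * (ac * gb * n)
      ≤ m * (bb * cc) := by
  rcases hm with rfl | rfl <;> rcases hbb with rfl | rfl <;> rcases hcc with rfl | rfl <;> rcases hac with rfl | rfl <;>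
    rcases hgc with rfl | rfl <;> rcases hab with rfl | rfl <;> rcases hgb with rfl | rfl <;> rcases hn with rfl | rfl <;> omega

end Pointwise


section Filters

variable {α β : Type*} [PartialOrder α] [PartialOrder β] [Fintype α] [Fintype β] [DecidableEq α] [DecidableEq β]

omit [Fintype α] in
/-- Rows of `W ∩ (α × (G ∖ E))` are up-sets (`W` with up-set rows, `G` an up-set, `E` a down-set). [this work] -/
theorem isUpperSet_row_filter_snd {W : Finset (α × β)} (hW : IsUpperSet (W : Set (α × β))) {G E : Finset β}
    (hG : IsUpperSet (G : Set β)) (hE : IsLowerSet (E : Set β)) (x : α) :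
    IsUpperSet ((univ.filter fun y : β => (x, y) ∈ W.filter (fun p : α × β => p.2 ∈ G ∧ p.2 ∉ E) : Finset β) : Set β) := by
  intro y y' hyy' hy
  rw [Finset.mem_coe, Finset.mem_filter, Finset.mem_filter] at hy ⊢
  refine ⟨mem_univ _, hW (show (x, y) ≤ (x, y') from ⟨le_rfl, hyy'⟩) hy.2.1, hG hyy' hy.2.2.1, fun h => hy.2.2.2 (hE hyy' h)⟩

omit [Fintype β] in
/-- Columns of `W ∩ ((A ∖ D) × β)` are up-sets. [this work] -/
theorem isUpperSet_col_filter_fst {W : Finset (α × β)} (hW : IsUpperSet (W : Set (α × β))) {A D : Finset α}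
    (hA : IsUpperSet (A : Set α)) (hD : IsLowerSet (D : Set α)) (y : β) :
    IsUpperSet ((univ.filter fun x : α => (x, y) ∈ W.filter (fun p : α × β => p.1 ∈ A ∧ p.1 ∉ D) : Finset α) : Set α) := by
  intro x x' hxx' hx
  rw [Finset.mem_coe, Finset.mem_filter, Finset.mem_filter] at hx ⊢
  refine ⟨mem_univ _, hW (show (x, y) ≤ (x', y) from ⟨hxx', le_rfl⟩) hx.2.1, hA hxx' hx.2.2.1, fun h => hx.2.2.2 (hD hxx' h)⟩

omit [PartialOrder α] [PartialOrder β] [Fintype α] [Fintype β] in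
/-- Indicator of `W ∩ (α × (G ∖ E))`. [this work] -/
theorem ind_filter_snd (W : Finset (α × β)) (G E : Finset β) (p : α × β) :
    ind (W.filter (fun p : α × β => p.2 ∈ G ∧ p.2 ∉ E)) p = ind W p * (ind G p.2 * (1 - ind E p.2)) := by
  unfold ind
  by_cases h1 : p ∈ W <;> by_cases h2 : p.2 ∈ G <;> by_cases h3 : p.2 ∈ E <;> simp [Finset.mem_filter, h1, h2, h3]

omit [PartialOrder α] [PartialOrder β] [Fintype α] [Fintype β] in
/-- Indicator of `W ∩ ((A ∖ D) × β)`. [this work] -/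
theorem ind_filter_fst (W : Finset (α × β)) (A D : Finset α) (p : α × β) :
    ind (W.filter (fun p : α × β => p.1 ∈ A ∧ p.1 ∉ D)) p = ind W p * (ind A p.1 * (1 - ind D p.1)) := by
  unfold ind
  by_cases h1 : p ∈ W <;> by_cases h2 : p.1 ∈ A <;> by_cases h3 : p.1 ∈ D <;> simp [Finset.mem_filter, h1, h2, h3]

end Filters

section Main

variable {α β : Type*} [PartialOrder α] [PartialOrder β] [Fintype α] [Fintype β] [DecidableEq α] [DecidableEq β]

/-- **THE TWO-CHART TRANSPORT LEMMA** (generation 18's abstract claim `AC(t,t′)`, in the generality of two finite posets and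
HK-dominated down-sets; see the module docstring for the statement in words and the proof).  For up-sets `U, b, c ⊆ α × β`, arms
`A_b × β, α × G_b ⊆ b`, `A_c × β, α × G_c ⊆ c` (up-sets), and down-sets `D₁, D₂ ⊆ α`, `E₁, E₂ ⊆ β` with `#(V∩D₁) ≤ #(V∩A_b)`,
`#(V∩D₂) ≤ #(V∩A_c)`, `#(W∩E₁) ≤ #(W∩G_c)`, `#(W∩E₂) ≤ #(W∩G_b)` for all up-sets `V ⊆ α`, `W ⊆ β`:
`0 ≤ Σ_{(x,y)∈U} [(1_{D₁}(x) − 1_b)(1_{E₁}(y) − 1_c) + (1_{E₂}(y) − 1_b)(1_{D₂}(x) − 1_c)]`. [this work] -/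
theorem twoChart_sum_nonneg (U b c : Finset (α × β)) (hU : IsUpperSet (U : Set (α × β)))
    (hb : IsUpperSet (b : Set (α × β))) (hc : IsUpperSet (c : Set (α × β)))
    (Ab Ac D₁ D₂ : Finset α) (Gb Gc E₁ E₂ : Finset β)
    (hAb : IsUpperSet (Ab : Set α)) (hAc : IsUpperSet (Ac : Set α)) (hGb : IsUpperSet (Gb : Set β)) (hGc : IsUpperSet (Gc : Set β))
    (hD₁ : IsLowerSet (D₁ : Set α)) (hD₂ : IsLowerSet (D₂ : Set α)) (hE₁ : IsLowerSet (E₁ : Set β)) (hE₂ : IsLowerSet (E₂ : Set β))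
    (hAb_b : ∀ x ∈ Ab, ∀ y, (x, y) ∈ b) (hGb_b : ∀ y ∈ Gb, ∀ x, (x, y) ∈ b)
    (hAc_c : ∀ x ∈ Ac, ∀ y, (x, y) ∈ c) (hGc_c : ∀ y ∈ Gc, ∀ x, (x, y) ∈ c)
    (hk₁ : ∀ V : Finset α, IsUpperSet (V : Set α) → (V ∩ D₁).card ≤ (V ∩ Ab).card)
    (hk₂ : ∀ V : Finset α, IsUpperSet (V : Set α) → (V ∩ D₂).card ≤ (V ∩ Ac).card)
    (hk₃ : ∀ W : Finset β, IsUpperSet (W : Set β) → (W ∩ E₁).card ≤ (W ∩ Gc).card)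
    (hk₄ : ∀ W : Finset β, IsUpperSet (W : Set β) → (W ∩ E₂).card ≤ (W ∩ Gb).card) :
    0 ≤ ∑ p ∈ U, ((ind D₁ p.1 - ind b p) * (ind E₁ p.2 - ind c p) + (ind E₂ p.2 - ind b p) * (ind D₂ p.1 - ind c p)) := by
  -- membership implications as indicator inequalities
  have hab' : ∀ p : α × β, ind Ab p.1 ≤ ind b p := fun p => ind_le_ind_of_imp fun h => by simpa using hAb_b p.1 h p.2
  have hgb' : ∀ p : α × β, ind Gb p.2 ≤ ind b p := fun p => ind_le_ind_of_imp fun h => by simpa using hGb_b p.2 h p.1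
  have hac' : ∀ p : α × β, ind Ac p.1 ≤ ind c p := fun p => ind_le_ind_of_imp fun h => by simpa using hAc_c p.1 h p.2
  have hgc' : ∀ p : α × β, ind Gc p.2 ≤ ind c p := fun p => ind_le_ind_of_imp fun h => by simpa using hGc_c p.2 h p.1
  -- Step 0: the sum as an indicator sum, and the pointwise decomposition into the six unit counts
  rw [sum_mem_eq_sum_ind_mul]
  have hmain :
      (∑ p : α × β, ind U p * (1 - ind D₁ p.1) * (1 - ind E₁ p.2) * (ind b p * ind c p))
        - (∑ p : α × β, ind U p * ind b p * (1 - ind c p) * (1 - ind D₁ p.1) * ind E₁ p.2)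
        - (∑ p : α × β, ind U p * ind c p * (1 - ind b p) * ind D₁ p.1 * (1 - ind E₁ p.2))
        + ((∑ p : α × β, ind U p * (1 - ind D₂ p.1) * (1 - ind E₂ p.2) * (ind b p * ind c p))
          - (∑ p : α × β, ind U p * ind b p * (1 - ind c p) * ind D₂ p.1 * (1 - ind E₂ p.2))
          - (∑ p : α × β, ind U p * ind c p * (1 - ind b p) * (1 - ind D₂ p.1) * ind E₂ p.2))
      ≤ ∑ p : α × β, ind U p * ((ind D₁ p.1 - ind b p) * (ind E₁ p.2 - ind c p) + (ind E₂ p.2 - ind b p) * (ind D₂ p.1 - ind c p)) := by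
    rw [← Finset.sum_sub_distrib, ← Finset.sum_sub_distrib, ← Finset.sum_sub_distrib, ← Finset.sum_sub_distrib, ← Finset.sum_add_distrib]
    exact Finset.sum_le_sum fun p _ => pw_main _ _ _ _ _ _ _ (ind_eq_zero_or_one U p) (ind_eq_zero_or_one b p) (ind_eq_zero_or_one c p) (ind_eq_zero_or_one D₁ p.1) (ind_eq_zero_or_one E₁ p.2)
      (ind_eq_zero_or_one D₂ p.1) (ind_eq_zero_or_one E₂ p.2)
  -- Step 1: the four negative counts are dominated by arm regions (pointwise, then row/column HK)
  have I1a : (∑ p : α × β, ind U p * ind b p * (1 - ind c p) * (1 - ind D₁ p.1) * ind E₁ p.2)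
      ≤ ∑ p : α × β, ind U p * ind b p * (1 - ind D₁ p.1) * (1 - ind Ac p.1) * (ind E₁ p.2 * (1 - ind Gc p.2)) :=
    Finset.sum_le_sum fun p _ => pw_neg _ _ _ _ _ _ _ (ind_eq_zero_or_one U p) (ind_eq_zero_or_one b p) (ind_eq_zero_or_one c p) (one_sub_zero_or_one (ind_eq_zero_or_one D₁ p.1)) (ind_eq_zero_or_one E₁ p.2)
      (ind_eq_zero_or_one Ac p.1) (ind_eq_zero_or_one Gc p.2) (hac' p) (hgc' p)
  have I1b : (∑ p : α × β, ind U p * ind b p * (1 - ind D₁ p.1) * (1 - ind Ac p.1) * (ind E₁ p.2 * (1 - ind Gc p.2)))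
      ≤ ∑ p : α × β, ind U p * (1 - ind D₁ p.1) * (1 - ind E₁ p.2) * (ind b p * (1 - ind Ac p.1) * ind Gc p.2) := by
    have key := rowHK hk₃ (U ∩ b) (fun x => isUpperSet_row (isUpperSet_inter_coe' hU hb) x)
      (fun x => (1 - ind D₁ x) * (1 - ind Ac x)) (fun x => mul_nonneg (sub_nonneg.2 (ind_le_one' D₁ x)) (sub_nonneg.2 (ind_le_one' Ac x)))
    have e : (∑ p : α × β, ind U p * ind b p * (1 - ind D₁ p.1) * (1 - ind Ac p.1) * (ind E₁ p.2 * (1 - ind Gc p.2)))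
        - (∑ p : α × β, ind U p * (1 - ind D₁ p.1) * (1 - ind E₁ p.2) * (ind b p * (1 - ind Ac p.1) * ind Gc p.2))
        = (∑ p : α × β, ind (U ∩ b) p * ((1 - ind D₁ p.1) * (1 - ind Ac p.1)) * ind E₁ p.2)
          - (∑ p : α × β, ind (U ∩ b) p * ((1 - ind D₁ p.1) * (1 - ind Ac p.1)) * ind Gc p.2) := by
      rw [← Finset.sum_sub_distrib, ← Finset.sum_sub_distrib]
      exact Finset.sum_congr rfl fun p _ => by rw [ind_inter_eq_mul]; ring
    linarith
  have I3a : (∑ p : α × β, ind U p * ind c p * (1 - ind b p) * ind D₁ p.1 * (1 - ind E₁ p.2))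
      ≤ ∑ p : α × β, ind U p * ind c p * ind D₁ p.1 * (1 - ind Ab p.1) * ((1 - ind E₁ p.2) * (1 - ind Gb p.2)) :=
    Finset.sum_le_sum fun p _ => pw_neg _ _ _ _ _ _ _ (ind_eq_zero_or_one U p) (ind_eq_zero_or_one c p) (ind_eq_zero_or_one b p) (ind_eq_zero_or_one D₁ p.1) (one_sub_zero_or_one (ind_eq_zero_or_one E₁ p.2))
      (ind_eq_zero_or_one Ab p.1) (ind_eq_zero_or_one Gb p.2) (hab' p) (hgb' p)
  have I3b : (∑ p : α × β, ind U p * ind c p * ind D₁ p.1 * (1 - ind Ab p.1) * ((1 - ind E₁ p.2) * (1 - ind Gb p.2)))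
      ≤ ∑ p : α × β, ind U p * (1 - ind D₁ p.1) * (1 - ind E₁ p.2) * (ind c p * ind Ab p.1 * (1 - ind Gb p.2)) := by
    have key := colHK hk₁ (U ∩ c) (fun y => isUpperSet_col (isUpperSet_inter_coe' hU hc) y)
      (fun y => (1 - ind E₁ y) * (1 - ind Gb y)) (fun y => mul_nonneg (sub_nonneg.2 (ind_le_one' E₁ y)) (sub_nonneg.2 (ind_le_one' Gb y)))
    have e : (∑ p : α × β, ind U p * ind c p * ind D₁ p.1 * (1 - ind Ab p.1) * ((1 - ind E₁ p.2) * (1 - ind Gb p.2)))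
        - (∑ p : α × β, ind U p * (1 - ind D₁ p.1) * (1 - ind E₁ p.2) * (ind c p * ind Ab p.1 * (1 - ind Gb p.2)))
        = (∑ p : α × β, ind (U ∩ c) p * ((1 - ind E₁ p.2) * (1 - ind Gb p.2)) * ind D₁ p.1)
          - (∑ p : α × β, ind (U ∩ c) p * ((1 - ind E₁ p.2) * (1 - ind Gb p.2)) * ind Ab p.1) := by
      rw [← Finset.sum_sub_distrib, ← Finset.sum_sub_distrib]
      exact Finset.sum_congr rfl fun p _ => by rw [ind_inter_eq_mul]; ring
    linarith
  have I2a : (∑ p : α × β, ind U p * ind b p * (1 - ind c p) * ind D₂ p.1 * (1 - ind E₂ p.2))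
      ≤ ∑ p : α × β, ind U p * ind b p * ind D₂ p.1 * (1 - ind Ac p.1) * ((1 - ind E₂ p.2) * (1 - ind Gc p.2)) :=
    Finset.sum_le_sum fun p _ => pw_neg _ _ _ _ _ _ _ (ind_eq_zero_or_one U p) (ind_eq_zero_or_one b p) (ind_eq_zero_or_one c p) (ind_eq_zero_or_one D₂ p.1) (one_sub_zero_or_one (ind_eq_zero_or_one E₂ p.2))
      (ind_eq_zero_or_one Ac p.1) (ind_eq_zero_or_one Gc p.2) (hac' p) (hgc' p)
  have I2b : (∑ p : α × β, ind U p * ind b p * ind D₂ p.1 * (1 - ind Ac p.1) * ((1 - ind E₂ p.2) * (1 - ind Gc p.2)))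
      ≤ ∑ p : α × β, ind U p * (1 - ind D₂ p.1) * (1 - ind E₂ p.2) * (ind b p * ind Ac p.1 * (1 - ind Gc p.2)) := by
    have key := colHK hk₂ (U ∩ b) (fun y => isUpperSet_col (isUpperSet_inter_coe' hU hb) y)
      (fun y => (1 - ind E₂ y) * (1 - ind Gc y)) (fun y => mul_nonneg (sub_nonneg.2 (ind_le_one' E₂ y)) (sub_nonneg.2 (ind_le_one' Gc y)))
    have e : (∑ p : α × β, ind U p * ind b p * ind D₂ p.1 * (1 - ind Ac p.1) * ((1 - ind E₂ p.2) * (1 - ind Gc p.2)))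
        - (∑ p : α × β, ind U p * (1 - ind D₂ p.1) * (1 - ind E₂ p.2) * (ind b p * ind Ac p.1 * (1 - ind Gc p.2)))
        = (∑ p : α × β, ind (U ∩ b) p * ((1 - ind E₂ p.2) * (1 - ind Gc p.2)) * ind D₂ p.1)
          - (∑ p : α × β, ind (U ∩ b) p * ((1 - ind E₂ p.2) * (1 - ind Gc p.2)) * ind Ac p.1) := by
      rw [← Finset.sum_sub_distrib, ← Finset.sum_sub_distrib]
      exact Finset.sum_congr rfl fun p _ => by rw [ind_inter_eq_mul]; ring
    linarith
  have I4a : (∑ p : α × β, ind U p * ind c p * (1 - ind b p) * (1 - ind D₂ p.1) * ind E₂ p.2)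
      ≤ ∑ p : α × β, ind U p * ind c p * (1 - ind D₂ p.1) * (1 - ind Ab p.1) * (ind E₂ p.2 * (1 - ind Gb p.2)) :=
    Finset.sum_le_sum fun p _ => pw_neg _ _ _ _ _ _ _ (ind_eq_zero_or_one U p) (ind_eq_zero_or_one c p) (ind_eq_zero_or_one b p) (one_sub_zero_or_one (ind_eq_zero_or_one D₂ p.1)) (ind_eq_zero_or_one E₂ p.2)
      (ind_eq_zero_or_one Ab p.1) (ind_eq_zero_or_one Gb p.2) (hab' p) (hgb' p)
  have I4b : (∑ p : α × β, ind U p * ind c p * (1 - ind D₂ p.1) * (1 - ind Ab p.1) * (ind E₂ p.2 * (1 - ind Gb p.2)))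
      ≤ ∑ p : α × β, ind U p * (1 - ind D₂ p.1) * (1 - ind E₂ p.2) * (ind c p * (1 - ind Ab p.1) * ind Gb p.2) := by
    have key := rowHK hk₄ (U ∩ c) (fun x => isUpperSet_row (isUpperSet_inter_coe' hU hc) x)
      (fun x => (1 - ind D₂ x) * (1 - ind Ab x)) (fun x => mul_nonneg (sub_nonneg.2 (ind_le_one' D₂ x)) (sub_nonneg.2 (ind_le_one' Ab x)))
    have e : (∑ p : α × β, ind U p * ind c p * (1 - ind D₂ p.1) * (1 - ind Ab p.1) * (ind E₂ p.2 * (1 - ind Gb p.2)))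
        - (∑ p : α × β, ind U p * (1 - ind D₂ p.1) * (1 - ind E₂ p.2) * (ind c p * (1 - ind Ab p.1) * ind Gb p.2))
        = (∑ p : α × β, ind (U ∩ c) p * ((1 - ind D₂ p.1) * (1 - ind Ab p.1)) * ind E₂ p.2)
          - (∑ p : α × β, ind (U ∩ c) p * ((1 - ind D₂ p.1) * (1 - ind Ab p.1)) * ind Gb p.2) := by
      rw [← Finset.sum_sub_distrib, ← Finset.sum_sub_distrib]
      exact Finset.sum_congr rfl fun p _ => by rw [ind_inter_eq_mul]; ring
    linarith
  -- Step 2: the overlap regions K1, K2 are dominated by the free regions Z1, Z2 (two HK steps each)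
  have Z1a : (∑ p : α × β, ind U p * (1 - ind D₁ p.1) * (1 - ind E₁ p.2) * (ind Ab p.1 * (1 - ind Ac p.1) * ind Gc p.2 * (1 - ind Gb p.2)))
      ≤ ∑ p : α × β, ind U p * (1 - ind D₁ p.1) * (1 - ind E₁ p.2) * (ind Ab p.1 * (1 - ind Ac p.1) * ind Gc p.2 * (1 - ind E₂ p.2)) := by
    have key := rowHK hk₄ (U.filter (fun p : α × β => p.2 ∈ Gc ∧ p.2 ∉ E₁)) (fun x => isUpperSet_row_filter_snd hU hGc hE₁ x)
      (fun x => (1 - ind D₁ x) * ind Ab x * (1 - ind Ac x))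
      (fun x => mul_nonneg (mul_nonneg (sub_nonneg.2 (ind_le_one' D₁ x)) (ind_nonneg' Ab x)) (sub_nonneg.2 (ind_le_one' Ac x)))
    have e : (∑ p : α × β, ind U p * (1 - ind D₁ p.1) * (1 - ind E₁ p.2) * (ind Ab p.1 * (1 - ind Ac p.1) * ind Gc p.2 * (1 - ind Gb p.2)))
        - (∑ p : α × β, ind U p * (1 - ind D₁ p.1) * (1 - ind E₁ p.2) * (ind Ab p.1 * (1 - ind Ac p.1) * ind Gc p.2 * (1 - ind E₂ p.2)))
        = (∑ p : α × β, ind (U.filter (fun p : α × β => p.2 ∈ Gc ∧ p.2 ∉ E₁)) p * ((1 - ind D₁ p.1) * ind Ab p.1 * (1 - ind Ac p.1)) * ind E₂ p.2)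
          - (∑ p : α × β, ind (U.filter (fun p : α × β => p.2 ∈ Gc ∧ p.2 ∉ E₁)) p * ((1 - ind D₁ p.1) * ind Ab p.1 * (1 - ind Ac p.1)) * ind Gb p.2) := by
      rw [← Finset.sum_sub_distrib, ← Finset.sum_sub_distrib]
      exact Finset.sum_congr rfl fun p _ => by rw [ind_filter_snd]; ring
    linarith
  have Z1b : (∑ p : α × β, ind U p * (1 - ind D₁ p.1) * (1 - ind E₁ p.2) * (ind Ab p.1 * (1 - ind Ac p.1) * ind Gc p.2 * (1 - ind E₂ p.2)))
      ≤ ∑ p : α × β, ind U p * (1 - ind D₁ p.1) * (1 - ind E₁ p.2) * (ind Ab p.1 * (1 - ind D₂ p.1) * ind Gc p.2 * (1 - ind E₂ p.2)) := by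
    have key := colHK hk₂ (U.filter (fun p : α × β => p.1 ∈ Ab ∧ p.1 ∉ D₁)) (fun y => isUpperSet_col_filter_fst hU hAb hD₁ y)
      (fun y => ind Gc y * (1 - ind E₁ y) * (1 - ind E₂ y))
      (fun y => mul_nonneg (mul_nonneg (ind_nonneg' Gc y) (sub_nonneg.2 (ind_le_one' E₁ y))) (sub_nonneg.2 (ind_le_one' E₂ y)))
    have e : (∑ p : α × β, ind U p * (1 - ind D₁ p.1) * (1 - ind E₁ p.2) * (ind Ab p.1 * (1 - ind Ac p.1) * ind Gc p.2 * (1 - ind E₂ p.2)))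
        - (∑ p : α × β, ind U p * (1 - ind D₁ p.1) * (1 - ind E₁ p.2) * (ind Ab p.1 * (1 - ind D₂ p.1) * ind Gc p.2 * (1 - ind E₂ p.2)))
        = (∑ p : α × β, ind (U.filter (fun p : α × β => p.1 ∈ Ab ∧ p.1 ∉ D₁)) p * (ind Gc p.2 * (1 - ind E₁ p.2) * (1 - ind E₂ p.2)) * ind D₂ p.1)
          - (∑ p : α × β, ind (U.filter (fun p : α × β => p.1 ∈ Ab ∧ p.1 ∉ D₁)) p * (ind Gc p.2 * (1 - ind E₁ p.2) * (1 - ind E₂ p.2)) * ind Ac p.1) := by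
      rw [← Finset.sum_sub_distrib, ← Finset.sum_sub_distrib]
      exact Finset.sum_congr rfl fun p _ => by rw [ind_filter_fst]; ring
    linarith
  have Z2a : (∑ p : α × β, ind U p * (1 - ind D₂ p.1) * (1 - ind E₂ p.2) * (ind Ac p.1 * (1 - ind Ab p.1) * ind Gb p.2 * (1 - ind Gc p.2)))
      ≤ ∑ p : α × β, ind U p * (1 - ind D₂ p.1) * (1 - ind E₂ p.2) * (ind Ac p.1 * (1 - ind Ab p.1) * ind Gb p.2 * (1 - ind E₁ p.2)) := by
    have key := rowHK hk₃ (U.filter (fun p : α × β => p.2 ∈ Gb ∧ p.2 ∉ E₂)) (fun x => isUpperSet_row_filter_snd hU hGb hE₂ x)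
      (fun x => (1 - ind D₂ x) * ind Ac x * (1 - ind Ab x))
      (fun x => mul_nonneg (mul_nonneg (sub_nonneg.2 (ind_le_one' D₂ x)) (ind_nonneg' Ac x)) (sub_nonneg.2 (ind_le_one' Ab x)))
    have e : (∑ p : α × β, ind U p * (1 - ind D₂ p.1) * (1 - ind E₂ p.2) * (ind Ac p.1 * (1 - ind Ab p.1) * ind Gb p.2 * (1 - ind Gc p.2)))
        - (∑ p : α × β, ind U p * (1 - ind D₂ p.1) * (1 - ind E₂ p.2) * (ind Ac p.1 * (1 - ind Ab p.1) * ind Gb p.2 * (1 - ind E₁ p.2)))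
        = (∑ p : α × β, ind (U.filter (fun p : α × β => p.2 ∈ Gb ∧ p.2 ∉ E₂)) p * ((1 - ind D₂ p.1) * ind Ac p.1 * (1 - ind Ab p.1)) * ind E₁ p.2)
          - (∑ p : α × β, ind (U.filter (fun p : α × β => p.2 ∈ Gb ∧ p.2 ∉ E₂)) p * ((1 - ind D₂ p.1) * ind Ac p.1 * (1 - ind Ab p.1)) * ind Gc p.2) := by
      rw [← Finset.sum_sub_distrib, ← Finset.sum_sub_distrib]
      exact Finset.sum_congr rfl fun p _ => by rw [ind_filter_snd]; ring
    linarith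
  have Z2b : (∑ p : α × β, ind U p * (1 - ind D₂ p.1) * (1 - ind E₂ p.2) * (ind Ac p.1 * (1 - ind Ab p.1) * ind Gb p.2 * (1 - ind E₁ p.2)))
      ≤ ∑ p : α × β, ind U p * (1 - ind D₂ p.1) * (1 - ind E₂ p.2) * (ind Ac p.1 * (1 - ind D₁ p.1) * ind Gb p.2 * (1 - ind E₁ p.2)) := by
    have key := colHK hk₁ (U.filter (fun p : α × β => p.1 ∈ Ac ∧ p.1 ∉ D₂)) (fun y => isUpperSet_col_filter_fst hU hAc hD₂ y)
      (fun y => ind Gb y * (1 - ind E₂ y) * (1 - ind E₁ y))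
      (fun y => mul_nonneg (mul_nonneg (ind_nonneg' Gb y) (sub_nonneg.2 (ind_le_one' E₂ y))) (sub_nonneg.2 (ind_le_one' E₁ y)))
    have e : (∑ p : α × β, ind U p * (1 - ind D₂ p.1) * (1 - ind E₂ p.2) * (ind Ac p.1 * (1 - ind Ab p.1) * ind Gb p.2 * (1 - ind E₁ p.2)))
        - (∑ p : α × β, ind U p * (1 - ind D₂ p.1) * (1 - ind E₂ p.2) * (ind Ac p.1 * (1 - ind D₁ p.1) * ind Gb p.2 * (1 - ind E₁ p.2)))
        = (∑ p : α × β, ind (U.filter (fun p : α × β => p.1 ∈ Ac ∧ p.1 ∉ D₂)) p * (ind Gb p.2 * (1 - ind E₂ p.2) * (1 - ind E₁ p.2)) * ind D₁ p.1)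
          - (∑ p : α × β, ind (U.filter (fun p : α × β => p.1 ∈ Ac ∧ p.1 ∉ D₂)) p * (ind Gb p.2 * (1 - ind E₂ p.2) * (1 - ind E₁ p.2)) * ind Ab p.1) := by
      rw [← Finset.sum_sub_distrib, ← Finset.sum_sub_distrib]
      exact Finset.sum_congr rfl fun p _ => by rw [ind_filter_fst]; ring
    linarith
  -- the free regions, rewritten with the other chart's prefix
  have eZ1 : (∑ p : α × β, ind U p * (1 - ind D₁ p.1) * (1 - ind E₁ p.2) * (ind Ab p.1 * (1 - ind D₂ p.1) * ind Gc p.2 * (1 - ind E₂ p.2)))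
      = ∑ p : α × β, ind U p * (1 - ind D₂ p.1) * (1 - ind E₂ p.2) * (ind Ab p.1 * ind Gc p.2 * ((1 - ind D₁ p.1) * (1 - ind E₁ p.2))) :=
    Finset.sum_congr rfl fun p _ => by ring
  have eZ2 : (∑ p : α × β, ind U p * (1 - ind D₂ p.1) * (1 - ind E₂ p.2) * (ind Ac p.1 * (1 - ind D₁ p.1) * ind Gb p.2 * (1 - ind E₁ p.2)))
      = ∑ p : α × β, ind U p * (1 - ind D₁ p.1) * (1 - ind E₁ p.2) * (ind Ac p.1 * ind Gb p.2 * ((1 - ind D₂ p.1) * (1 - ind E₂ p.2))) :=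
    Finset.sum_congr rfl fun p _ => by ring
  have eP2 : (∑ p : α × β, ind U p * (1 - ind D₂ p.1) * (1 - ind E₂ p.2) * (ind c p * ind b p))
      = ∑ p : α × β, ind U p * (1 - ind D₂ p.1) * (1 - ind E₂ p.2) * (ind b p * ind c p) :=
    Finset.sum_congr rfl fun p _ => by ring
  -- Step 3: pointwise, each chart's positive count covers its two arm regions minus the overlap plus the other chart's free region
  have F1 : (∑ p : α × β, ind U p * (1 - ind D₁ p.1) * (1 - ind E₁ p.2) * (ind b p * (1 - ind Ac p.1) * ind Gc p.2))
      + (∑ p : α × β, ind U p * (1 - ind D₁ p.1) * (1 - ind E₁ p.2) * (ind c p * ind Ab p.1 * (1 - ind Gb p.2)))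
      - (∑ p : α × β, ind U p * (1 - ind D₁ p.1) * (1 - ind E₁ p.2) * (ind Ab p.1 * (1 - ind Ac p.1) * ind Gc p.2 * (1 - ind Gb p.2)))
      + (∑ p : α × β, ind U p * (1 - ind D₁ p.1) * (1 - ind E₁ p.2) * (ind Ac p.1 * ind Gb p.2 * ((1 - ind D₂ p.1) * (1 - ind E₂ p.2))))
      ≤ ∑ p : α × β, ind U p * (1 - ind D₁ p.1) * (1 - ind E₁ p.2) * (ind b p * ind c p) := by
    rw [← Finset.sum_add_distrib, ← Finset.sum_sub_distrib, ← Finset.sum_add_distrib]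
    exact Finset.sum_le_sum fun p _ => pw_overlap _ _ _ _ _ _ _ _
      (mul_zero_or_one (mul_zero_or_one (ind_eq_zero_or_one U p) (one_sub_zero_or_one (ind_eq_zero_or_one D₁ p.1))) (one_sub_zero_or_one (ind_eq_zero_or_one E₁ p.2))) (ind_eq_zero_or_one b p) (ind_eq_zero_or_one c p) (ind_eq_zero_or_one Ac p.1) (ind_eq_zero_or_one Gc p.2)
      (ind_eq_zero_or_one Ab p.1) (ind_eq_zero_or_one Gb p.2) (mul_zero_or_one (one_sub_zero_or_one (ind_eq_zero_or_one D₂ p.1)) (one_sub_zero_or_one (ind_eq_zero_or_one E₂ p.2))) (hab' p) (hgb' p) (hac' p) (hgc' p)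
  have F2 : (∑ p : α × β, ind U p * (1 - ind D₂ p.1) * (1 - ind E₂ p.2) * (ind c p * (1 - ind Ab p.1) * ind Gb p.2))
      + (∑ p : α × β, ind U p * (1 - ind D₂ p.1) * (1 - ind E₂ p.2) * (ind b p * ind Ac p.1 * (1 - ind Gc p.2)))
      - (∑ p : α × β, ind U p * (1 - ind D₂ p.1) * (1 - ind E₂ p.2) * (ind Ac p.1 * (1 - ind Ab p.1) * ind Gb p.2 * (1 - ind Gc p.2)))
      + (∑ p : α × β, ind U p * (1 - ind D₂ p.1) * (1 - ind E₂ p.2) * (ind Ab p.1 * ind Gc p.2 * ((1 - ind D₁ p.1) * (1 - ind E₁ p.2))))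
      ≤ ∑ p : α × β, ind U p * (1 - ind D₂ p.1) * (1 - ind E₂ p.2) * (ind c p * ind b p) := by
    rw [← Finset.sum_add_distrib, ← Finset.sum_sub_distrib, ← Finset.sum_add_distrib]
    exact Finset.sum_le_sum fun p _ => pw_overlap _ _ _ _ _ _ _ _
      (mul_zero_or_one (mul_zero_or_one (ind_eq_zero_or_one U p) (one_sub_zero_or_one (ind_eq_zero_or_one D₂ p.1))) (one_sub_zero_or_one (ind_eq_zero_or_one E₂ p.2))) (ind_eq_zero_or_one c p) (ind_eq_zero_or_one b p) (ind_eq_zero_or_one Ab p.1) (ind_eq_zero_or_one Gb p.2)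
      (ind_eq_zero_or_one Ac p.1) (ind_eq_zero_or_one Gc p.2) (mul_zero_or_one (one_sub_zero_or_one (ind_eq_zero_or_one D₁ p.1)) (one_sub_zero_or_one (ind_eq_zero_or_one E₁ p.2))) (hac' p) (hgc' p) (hab' p) (hgb' p)
  linarith

end Main

end Summit.CriticalPhenomena.PercolationContinuityZ3.Theorems.SahiGridPattern
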